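/-
Copyright (c) 2026 the pub-hodgecm-mathlib formalisation cell (harness21).  Prover seat hodgecm-mathlib-F0P3b-p01 (g11), 2026-09-01.  Road «S3-tree» (census «S3» v3, architect
A-p16 (g29)), brick T3′ «depth-zero κ-transfer», organ O6 of the holder's DESIGN v1 (`F0/P3/F0P3b-p01/g11/T3prime-DESIGN.v1.F0P3bp01g11.md`): Euler's trace-dual lemma for the
monogenic order `O[γ]` inside the SPLIT algebra `Kⁿ`, and the Gram matrix of a cyclic lattice.
-/
import Mathlib.LinearAlgebra.Lagrange
import Mathlib.LinearAlgebra.Vandermonde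
import Mathlib.Algebra.Polynomial.Div
import Mathlib.Algebra.Polynomial.Lifts
import Mathlib.RingTheory.Polynomial.Basic
import HarnessLib

/-!
# The trace dual of the monogenic order `O[γ] ⊂ Kⁿ` (Euler's lemma, split form) and the Gram matrix of a cyclic lattice

Topic `NumberTheory/Automorphic`; namespace `Literature.NumberTheory.Automorphic`.  THEOREMS ONLY (no definition, no instance, no notation, no named fact, no `sorry`);
Mathlib-only imports; any field `K`, any subring `O ≤ K`, any `n`.  Cell `pub/hodgecm-mathlib`, crux H413 = `stmt-HodgeConjecture-24833`; road «S3-tree», brick T3′ (the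
regular-unipotent Jordan stratum of the fixed hyperspecial vertices = the SELF-DUAL CYCLIC `O_w[γ]`-lattices; DESIGN v1 §1–§2, organ O6).  HONEST LABEL: HC_CM is proved only
modulo the cell's 2 remaining named inputs (hLiu418, h413) until rung 0 closes; this file is elementary polynomial algebra and asserts nothing printed.

THE MATHEMATICS.  `γ : Fin n → K` injective with `γ i ∈ O`; `f = ∏ (X − γ_i)` (Mathlib `Lagrange.nodal`), `f′(γ_i) = ∏_{j ≠ i} (γ_i − γ_j)`.  The order
`R = O[γ] = span_O {(γ_i^j)_i : j < n} ⊂ Kⁿ` (componentwise powers; ALL values `(P(γ_i))_i`, `P ∈ O[X]`, lie in it since `f` is monic of degree `n` over `O`, §0)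
has TRACE DUAL `R^∨ := {δ ∈ Kⁿ | ∀ r ∈ R, Σ_i r_i δ_i ∈ O} = f′(γ)⁻¹ · R` (Euler):
* §1 (`R^∨ ⊇ f′(γ)⁻¹R`) `sum_mul_eval_mem_of_mul_nodalDeriv_mem_span` — if `(δ_i f′(γ_i))_i ∈ R` then `Σ_i δ_i P(γ_i) ∈ O` for EVERY `P ∈ O[X]`
  (`Σ_i Q(γ_i)∕f′(γ_i)` is the `X^{n−1}`-coefficient of `Q mod f`, Mathlib `Lagrange.coeff_eq_sum`);
* §2 (`R^∨ ⊆ f′(γ)⁻¹R`) `mul_nodalDeriv_mem_span_of_sum_mul_pow_mem` — if `Σ_i δ_i γ_i^m ∈ O` for `m < n` then `(δ_i f′(γ_i))_i ∈ R` (the interpolant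
  `Σ_i δ_i · f∕(X − γ_i)` has `O`-coefficients by synthetic division, Mathlib `Polynomial.coeff_divByMonic_X_sub_C`);
* §3 `mul_nodalDeriv_mem_span_iff` (the two together) and the variant with INVERSE powers when `γ_i⁻¹ = r(γ_i)` for one `r ∈ O[X]` (`γ ∈ O[γ]^×`);
* §4 THE GRAM MATRIX OF A CYCLIC LATTICE: for `σ : K →+* K` with `σ(γ_i) = γ_i⁻¹` (unitary eigenvalues) the matrix `G_{jk} = Σ_i δ_i σ(γ_i)^j γ_i^k` — the Gram matrix of the
  basis `{γ^k a}_k` of the cyclic lattice `O[γ]·a` for a diagonal hermitian form `diag(d)`, `δ_i = d_i a_i σ(a_i)` — equals `(σV)ᵀ · diag(δ) · V` (`V` = Vandermonde) and is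
  `O`-INTEGRAL iff `(δ_i f′(γ_i))_i ∈ O[γ]` (`gram_cyclic_integral_iff`); its determinant is `σ(det V) · (∏ δ_i) · det V` (`det_gram_cyclic`).
Consumer: T3′'s count of self-dual free `O_w[γ]`-lattices (organs O7∕O8): self-dual ⟺ `G ∈ GL_n(O)` ⟺ `(d_i a_i σ(a_i) f′(γ)_i)_i ∈ O[γ]^×`.

## References
* [SerreLocalFields1979] J.-P. Serre, *Local Fields* (1979), Ch. III §6 Prop. 12 and Cor. 2 (Euler's lemma: the dual basis of `1, x, …, x^{n−1}` for the trace form; `O[x]^∨ = f′(x)⁻¹O[x]`).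
* [Rogawski1990] J. D. Rogawski, *Automorphic Representations of Unitary Groups in Three Variables* (1990), §4.9 p. 54 (orbital integrals as lattice counts).
* [Jacobowitz1962] R. Jacobowitz, *Hermitian forms over local fields*, Amer. J. Math. 84 (1962), §4 (Gram matrices, dual lattices).
-/

set_option autoImplicit false

open Polynomial Finset Matrix

namespace Literature.NumberTheory.Automorphic

variable {K : Type*} [Field K] {n : ℕ} (O : Subring K) {γ : Fin n → K}

/-! ## §0 Bookkeeping: the nodal polynomial over `O`; values of `O`-polynomials lie in `O[γ]` -/

/-- The node polynomial `f = ∏ (X − γ_i)` has coefficients in `O` when the nodes do. [cite: SerreLocalFields1979, Ch. III §6] -/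
theorem coeff_nodal_mem (hγ : ∀ i, γ i ∈ O) (m : ℕ) : (Lagrange.nodal univ γ).coeff m ∈ O := by
  have h : Lagrange.nodal univ γ = (∏ i : Fin n, (X - Polynomial.C (⟨γ i, hγ i⟩ : O))).map O.subtype := by
    rw [Lagrange.nodal_eq, Polynomial.map_prod]
    simp
  rw [h, Polynomial.coeff_map]
  exact SetLike.coe_mem _

/-- `f′(γ_i) = ∏_{j ≠ i} (γ_i − γ_j) ≠ 0` for injective nodes. [cite: SerreLocalFields1979, Ch. III §6] -/
theorem prod_erase_sub_ne_zero (hinj : Function.Injective γ) (i : Fin n) : ∏ j ∈ univ.erase i, (γ i - γ j) ≠ 0 := by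
  rw [prod_ne_zero_iff]
  intro j hj
  exact sub_ne_zero_of_ne fun h => (mem_erase.1 hj).1 (hinj h).symm

/-- Values of an `O`-polynomial of degree `< n` at the nodes lie in `O[γ] = span_O {γ^j : j < n}`. [cite: SerreLocalFields1979, Ch. III §6] -/
theorem eval_mem_span_pow_of_natDegree_lt (P : O[X]) (hP : P.natDegree < n) :
    (fun i => (P.map O.subtype).eval (γ i)) ∈ Submodule.span O (Set.range fun j : Fin n => fun i => γ i ^ (j : ℕ)) := by
  have h : (fun i => (P.map O.subtype).eval (γ i)) = ∑ j : Fin n, P.coeff j • (fun i => γ i ^ (j : ℕ)) := by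
    funext i
    rw [Polynomial.eval_map, Polynomial.eval₂_eq_sum_range' O.subtype hP, Finset.sum_apply,
      ← Fin.sum_univ_eq_sum_range (fun j => O.subtype (P.coeff j) * γ i ^ j)]
    exact Finset.sum_congr rfl fun j _ => by rw [Pi.smul_apply, Subring.smul_def, smul_eq_mul, Subring.coe_subtype]
  rw [h]
  exact Submodule.sum_mem _ fun j _ => Submodule.smul_mem _ _ (Submodule.subset_span ⟨j, rfl⟩)

/-- Values of ANY `O`-polynomial at the nodes lie in `O[γ]` (reduce modulo the monic node polynomial of degree `n`). [cite: SerreLocalFields1979, Ch. III §6] -/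
theorem eval_mem_span_pow (hγ : ∀ i, γ i ∈ O) (P : O[X]) :
    (fun i => (P.map O.subtype).eval (γ i)) ∈ Submodule.span O (Set.range fun j : Fin n => fun i => γ i ^ (j : ℕ)) := by
  rcases Nat.eq_zero_or_pos n with hn | hn
  · subst hn
    have h0 : (fun i => (P.map O.subtype).eval (γ i)) = 0 := funext fun i => Fin.elim0 i
    rw [h0]
    exact Submodule.zero_mem _
  -- the node polynomial over `O`
  set fO : O[X] := ∏ i : Fin n, (X - Polynomial.C (⟨γ i, hγ i⟩ : O)) with hfO
  have hmon : fO.Monic := monic_prod_of_monic _ _ fun i _ => monic_X_sub_C _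
  have hdeg : fO.natDegree = n := by
    rw [hfO, natDegree_prod_of_monic _ _ fun i _ => monic_X_sub_C _]
    simp
  have hne1 : fO ≠ 1 := by
    intro h1
    have := congrArg Polynomial.natDegree h1
    rw [hdeg, natDegree_one] at this
    omega
  have hroot : ∀ i, (fO.map O.subtype).eval (γ i) = 0 := by
    intro i
    rw [hfO, Polynomial.map_prod, Polynomial.eval_prod]
    exact Finset.prod_eq_zero (Finset.mem_univ i) (by simp)
  have hval : (fun i => (P.map O.subtype).eval (γ i)) = fun i => ((P %ₘ fO).map O.subtype).eval (γ i) := by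
    funext i
    conv_lhs => rw [← modByMonic_add_div P fO]
    rw [Polynomial.map_add, Polynomial.map_mul, eval_add, eval_mul, hroot i, zero_mul, add_zero]
  rw [hval]
  exact eval_mem_span_pow_of_natDegree_lt O (P %ₘ fO) (hdeg ▸ natDegree_modByMonic_lt P hmon hne1)

/-! ## §1 Euler, first half: `f′(γ)⁻¹·O[γ] ⊆ O[γ]^∨` — power sums weighted by `δ` are integral -/

/-- **If `(δ_i f′(γ_i))_i ∈ O[γ]` then `Σ_i δ_i P(γ_i) ∈ O` for every `P ∈ O[X]`.** [cite: SerreLocalFields1979, Ch. III §6 Prop. 12, Cor. 2] -/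
theorem sum_mul_eval_mem_of_mul_nodalDeriv_mem_span (hγ : ∀ i, γ i ∈ O) (hinj : Function.Injective γ) {δ : Fin n → K}
    (hδ : (fun i => δ i * ∏ j ∈ univ.erase i, (γ i - γ j)) ∈ Submodule.span O (Set.range fun j : Fin n => fun i => γ i ^ (j : ℕ)))
    (P : O[X]) : ∑ i, δ i * (P.map O.subtype).eval (γ i) ∈ O := by
  rcases Nat.eq_zero_or_pos n with hn | hn
  · subst hn
    simp
  -- `δ f′ = p(γ)` for an `O`-polynomial `p` of degree `< n`
  obtain ⟨c, hc⟩ := (Submodule.mem_span_range_iff_exists_fun O).1 hδ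
  set p : O[X] := ∑ j : Fin n, Polynomial.C (c j) * X ^ (j : ℕ) with hp
  have hpeval : ∀ i, (p.map O.subtype).eval (γ i) = δ i * ∏ j ∈ univ.erase i, (γ i - γ j) := by
    intro i
    have := congrFun hc i
    simp only [Finset.sum_apply, Pi.smul_apply, Subring.smul_def, smul_eq_mul] at this
    rw [hp, Polynomial.map_sum, eval_finsetSum, ← this]
    exact Finset.sum_congr rfl fun j _ => by simp
  -- the node polynomial over `O` and `Q := (p · P) mod f`
  set fO : O[X] := ∏ i : Fin n, (X - Polynomial.C (⟨γ i, hγ i⟩ : O)) with hfO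
  have hmon : fO.Monic := monic_prod_of_monic _ _ fun i _ => monic_X_sub_C _
  have hdeg : fO.natDegree = n := by
    rw [hfO, natDegree_prod_of_monic _ _ fun i _ => monic_X_sub_C _]
    simp
  have hne1 : fO ≠ 1 := by
    intro h1
    have := congrArg Polynomial.natDegree h1
    rw [hdeg, natDegree_one] at this
    omega
  have hroot : ∀ i, (fO.map O.subtype).eval (γ i) = 0 := by
    intro i
    rw [hfO, Polynomial.map_prod, Polynomial.eval_prod]
    exact Finset.prod_eq_zero (Finset.mem_univ i) (by simp)
  set Q : O[X] := (p * P) %ₘ fO with hQ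
  have hQeval : ∀ i, (Q.map O.subtype).eval (γ i) = (δ i * ∏ j ∈ univ.erase i, (γ i - γ j)) * (P.map O.subtype).eval (γ i) := by
    intro i
    have h := modByMonic_add_div (p * P) fO
    have h' : ((p * P).map O.subtype).eval (γ i) = (Q.map O.subtype).eval (γ i) := by
      conv_lhs => rw [← h]
      rw [Polynomial.map_add, Polynomial.map_mul, eval_add, eval_mul, hroot i, zero_mul, add_zero]
    rw [← h', Polynomial.map_mul, eval_mul, hpeval i]
  have hQdeg : (Q.map O.subtype).degree < #(univ : Finset (Fin n)) := by
    rw [Finset.card_univ, Fintype.card_fin]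
    refine lt_of_le_of_lt degree_map_le ?_
    exact (degree_le_natDegree.trans_lt (by exact_mod_cast hdeg ▸ natDegree_modByMonic_lt (p * P) hmon hne1))
  -- Lagrange: the `X^{n−1}`-coefficient of `Q` is `Σ_i Q(γ_i)∕f′(γ_i) = Σ_i δ_i P(γ_i)`
  have hL := Lagrange.coeff_eq_sum (s := univ) (v := γ) (hinj.injOn) hQdeg
  have hsum : ∑ i, δ i * (P.map O.subtype).eval (γ i) =
      ∑ i ∈ univ, (Q.map O.subtype).eval (γ i) / ∏ j ∈ univ.erase i, (γ i - γ j) := by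
    refine Finset.sum_congr rfl fun i _ => ?_
    rw [hQeval i, mul_comm (δ i), mul_assoc, mul_div_assoc, mul_div_cancel_left₀ _ (prod_erase_sub_ne_zero hinj i), mul_comm]
  rw [hsum, ← hL, Polynomial.coeff_map]
  exact SetLike.coe_mem _

/-! ## §2 Euler, second half: `O[γ]^∨ ⊆ f′(γ)⁻¹·O[γ]` — from `n` integral power sums to membership -/

/-- **If `Σ_i δ_i γ_i^m ∈ O` for all `m < n` then `(δ_i f′(γ_i))_i ∈ O[γ]`** (the interpolant `Σ_i δ_i · f∕(X − γ_i)` has `O`-coefficients by synthetic division).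
[cite: SerreLocalFields1979, Ch. III §6 Prop. 12, Cor. 2] -/
theorem mul_nodalDeriv_mem_span_of_sum_mul_pow_mem (hγ : ∀ i, γ i ∈ O) {δ : Fin n → K}
    (h : ∀ m : ℕ, m < n → ∑ i, δ i * γ i ^ m ∈ O) :
    (fun i => δ i * ∏ j ∈ univ.erase i, (γ i - γ j)) ∈ Submodule.span O (Set.range fun j : Fin n => fun i => γ i ^ (j : ℕ)) := by
  rcases Nat.eq_zero_or_pos n with hn | hn
  · subst hn
    have h0 : (fun i : Fin 0 => δ i * ∏ j ∈ univ.erase i, (γ i - γ j)) = 0 := funext fun i => Fin.elim0 i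
    rw [h0]
    exact Submodule.zero_mem _
  set f : K[X] := Lagrange.nodal univ γ with hf
  have hfdeg : f.natDegree = n := by rw [hf, Lagrange.natDegree_nodal, Finset.card_univ, Fintype.card_fin]
  -- the interpolant
  set p : K[X] := ∑ i, Polynomial.C (δ i) * (f /ₘ (X - Polynomial.C (γ i))) with hp
  -- (a) its coefficients are `O`-combinations of the power sums
  have hcoeff : ∀ k, p.coeff k ∈ O := by
    intro k
    rw [hp, finsetSum_coeff]
    simp only [coeff_C_mul, coeff_divByMonic_X_sub_C, hfdeg, Finset.mul_sum]
    rw [Finset.sum_comm]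
    refine Subring.sum_mem _ fun m hm => ?_
    have hm' : m - (k + 1) < n := by
      have := (Finset.mem_Icc.1 hm).2
      omega
    have : ∑ i, δ i * (γ i ^ (m - (k + 1)) * f.coeff m) = (∑ i, δ i * γ i ^ (m - (k + 1))) * f.coeff m := by
      rw [Finset.sum_mul]
      exact Finset.sum_congr rfl fun i _ => by ring
    rw [this]
    exact Subring.mul_mem _ (h _ hm') (coeff_nodal_mem O hγ m)
  -- (b) so it lifts to `O[X]`, with the same degree bound
  obtain ⟨pO, hpO⟩ : ∃ pO : O[X], pO.map O.subtype = p := by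
    have : p ∈ Polynomial.lifts O.subtype := (lifts_iff_coeff_lifts p).2 fun k => ⟨⟨p.coeff k, hcoeff k⟩, rfl⟩
    exact (mem_lifts p).1 this
  have hquot : ∀ i, f /ₘ (X - Polynomial.C (γ i)) = Lagrange.nodal (univ.erase i) γ := by
    intro i
    rw [hf, Lagrange.nodal_eq_mul_nodal_erase (Finset.mem_univ i), mul_divByMonic_cancel_left _ (monic_X_sub_C _)]
  have hpdeg : pO.natDegree < n := by
    rw [← natDegree_map_eq_of_injective O.subtype_injective, hpO, hp]
    refine lt_of_le_of_lt (natDegree_sum_le_of_forall_le _ _ (n := n - 1) fun i _ => ?_) (by omega)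
    refine (natDegree_C_mul_le _ _).trans ?_
    rw [hquot i, Lagrange.natDegree_nodal, Finset.card_erase_of_mem (Finset.mem_univ i), Finset.card_univ, Fintype.card_fin]
  -- (c) its values at the nodes are `δ_i f′(γ_i)`
  have hpeval : ∀ i, p.eval (γ i) = δ i * ∏ j ∈ univ.erase i, (γ i - γ j) := by
    intro i
    rw [hp, eval_finsetSum, Finset.sum_eq_single i]
    · rw [eval_mul, eval_C, hquot i, Lagrange.eval_nodal]
    · intro i' _ hi'
      rw [eval_mul, hquot i', Lagrange.eval_nodal_at_node (Finset.mem_erase.2 ⟨fun h => hi' h.symm, Finset.mem_univ i⟩), mul_zero]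
    · exact fun hi => (hi (Finset.mem_univ i)).elim
  have hfun : (fun i => δ i * ∏ j ∈ univ.erase i, (γ i - γ j)) = fun i => (pO.map O.subtype).eval (γ i) := by
    funext i; rw [hpO, hpeval i]
  rw [hfun]
  exact eval_mem_span_pow_of_natDegree_lt O pO hpdeg

/-! ## §3 Euler's lemma (both halves) and the version with inverse powers -/

/-- **EULER'S LEMMA, split form: `(δ_i f′(γ_i))_i ∈ O[γ] ⟺ Σ_i δ_i γ_i^m ∈ O` for all `m < n`** (⟺ for all `m`, ⟺ `Σ_i δ_i P(γ_i) ∈ O` for all `P ∈ O[X]`).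
[cite: SerreLocalFields1979, Ch. III §6 Prop. 12, Cor. 2] -/
theorem mul_nodalDeriv_mem_span_iff (hγ : ∀ i, γ i ∈ O) (hinj : Function.Injective γ) (δ : Fin n → K) :
    (fun i => δ i * ∏ j ∈ univ.erase i, (γ i - γ j)) ∈ Submodule.span O (Set.range fun j : Fin n => fun i => γ i ^ (j : ℕ)) ↔
      ∀ m : ℕ, m < n → ∑ i, δ i * γ i ^ m ∈ O := by
  refine ⟨fun hδ m _ => ?_, mul_nodalDeriv_mem_span_of_sum_mul_pow_mem O hγ⟩
  have := sum_mul_eval_mem_of_mul_nodalDeriv_mem_span O hγ hinj hδ (X ^ m)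
  simpa using this

/-- **All power sums, positive AND negative, are integral** when `(δ_i f′(γ_i))_i ∈ O[γ]` and `γ` is a unit of `O[γ]` (`γ_i⁻¹ = r(γ_i)` for one `r ∈ O[X]` — e.g.
`γ_i ∈ O^×` roots of a monic `f` with `f(0) ∈ O^×`): `Σ_i δ_i (γ_i⁻¹)^j γ_i^k ∈ O`. [cite: SerreLocalFields1979, Ch. III §6 Cor. 2] -/
theorem sum_mul_inv_pow_mul_pow_mem (hγ : ∀ i, γ i ∈ O) (hinj : Function.Injective γ) {δ : Fin n → K}
    (hδ : (fun i => δ i * ∏ j ∈ univ.erase i, (γ i - γ j)) ∈ Submodule.span O (Set.range fun j : Fin n => fun i => γ i ^ (j : ℕ)))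
    {r : O[X]} (hr : ∀ i, (r.map O.subtype).eval (γ i) * γ i = 1) (j k : ℕ) :
    ∑ i, δ i * (γ i)⁻¹ ^ j * γ i ^ k ∈ O := by
  have h := sum_mul_eval_mem_of_mul_nodalDeriv_mem_span O hγ hinj hδ (r ^ j * X ^ k)
  have hinv : ∀ i, (γ i)⁻¹ = (r.map O.subtype).eval (γ i) := by
    intro i
    have hγ0 : γ i ≠ 0 := fun h0 => by simpa [h0] using hr i
    exact (eq_inv_of_mul_eq_one_left (hr i)).symm
  have : ∑ i, δ i * (γ i)⁻¹ ^ j * γ i ^ k = ∑ i, δ i * ((r ^ j * X ^ k).map O.subtype).eval (γ i) := by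
    refine Finset.sum_congr rfl fun i _ => ?_
    rw [hinv i, Polynomial.map_mul, Polynomial.map_pow, Polynomial.map_pow, Polynomial.map_X, eval_mul, eval_pow, eval_pow, eval_X, mul_assoc]
  rw [this]
  exact h

/-! ## §4 The Gram matrix of a cyclic lattice `O[γ]·a` for a diagonal hermitian form -/

/-- **The Gram matrix of the basis `{γ^k a}_k` is `(σV)ᵀ · diag(δ) · V`**, `V` the Vandermonde matrix of `γ`, `δ_i = d_i a_i σ(a_i)`:
`Σ_i δ_i σ(γ_i)^j γ_i^k = ((V.map σ)ᵀ * diagonal δ * V) j k`. [cite: Jacobowitz1962, §4] -/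
theorem gram_cyclic_eq (σ : K →+* K) (γ δ : Fin n → K) :
    (Matrix.of fun j k : Fin n => ∑ i, δ i * σ (γ i) ^ (j : ℕ) * γ i ^ (k : ℕ)) =
      ((vandermonde γ).map σ)ᵀ * diagonal δ * vandermonde γ := by
  ext j k
  rw [Matrix.mul_apply, Matrix.of_apply]
  refine Finset.sum_congr rfl fun i _ => ?_
  rw [Matrix.mul_diagonal, Matrix.transpose_apply, Matrix.map_apply, vandermonde_apply, vandermonde_apply, map_pow]
  ring

/-- **Determinant of the Gram matrix of a cyclic lattice**: `det((σV)ᵀ diag(δ) V) = σ(det V) · ∏ δ_i · det V` (with `det V = ∏_{i<j} (γ_j − γ_i)`, Mathlib `det_vandermonde`).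
[cite: Jacobowitz1962, §4] -/
theorem det_gram_cyclic (σ : K →+* K) (γ δ : Fin n → K) :
    (Matrix.of fun j k : Fin n => ∑ i, δ i * σ (γ i) ^ (j : ℕ) * γ i ^ (k : ℕ)).det = σ (vandermonde γ).det * (∏ i, δ i) * (vandermonde γ).det := by
  rw [gram_cyclic_eq, det_mul, det_mul, det_transpose, det_diagonal, ← RingHom.mapMatrix_apply, ← RingHom.map_det]

/-- **INTEGRALITY OF THE GRAM MATRIX OF A CYCLIC LATTICE ⟺ `δ·f′(γ) ∈ O[γ]`.**  For unitary eigenvalues (`σ(γ_i) = γ_i⁻¹`) which are units of `O[γ]` (`γ_i⁻¹ = r(γ_i)`):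
`(∀ j k, Σ_i δ_i σ(γ_i)^j γ_i^k ∈ O) ⟺ (δ_i f′(γ_i))_i ∈ span_O {γ^j : j < n}` — Euler's lemma read on the Gram matrix `(σV)ᵀ diag(δ) V` of `O[γ]·a` (`δ_i = d_i a_i σ(a_i)`).
[cite: SerreLocalFields1979, Ch. III §6 Cor. 2] [cite: Jacobowitz1962, §4] -/
theorem gram_cyclic_integral_iff (hγ : ∀ i, γ i ∈ O) (hinj : Function.Injective γ) (σ : K →+* K) (hσ : ∀ i, σ (γ i) = (γ i)⁻¹)
    {r : O[X]} (hr : ∀ i, (r.map O.subtype).eval (γ i) * γ i = 1) (δ : Fin n → K) :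
    (∀ j k : Fin n, ∑ i, δ i * σ (γ i) ^ (j : ℕ) * γ i ^ (k : ℕ) ∈ O) ↔
      (fun i => δ i * ∏ j ∈ univ.erase i, (γ i - γ j)) ∈ Submodule.span O (Set.range fun j : Fin n => fun i => γ i ^ (j : ℕ)) := by
  constructor
  · intro hG
    refine mul_nodalDeriv_mem_span_of_sum_mul_pow_mem O hγ fun m hm => ?_
    rcases Nat.eq_zero_or_pos n with hn | hn
    · omega
    have h0 := hG ⟨0, hn⟩ ⟨m, hm⟩
    simpa using h0
  · intro hδ j k
    have h := sum_mul_inv_pow_mul_pow_mem O hγ hinj hδ hr (j : ℕ) (k : ℕ)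
    simpa only [hσ] using h

end Literature.NumberTheory.Automorphic
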